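import Mathlib
import HarnessLib
import Summits.HodgeConjecture.HodgeConjecture.Theses.KleimanBFSeeds
import Literature.AlgebraicGeometry.HodgeTheory.ChernCharacterBettiTwistNormalised

/-!
# Route `KleimanBFSeeds`: the rung `WeilSixfolds` from K2 restricted to TWIST-NORMALISED Kleiman Chern characters
# (restatement certificate for crux stmt-HodgeConjecture-25931, evaluable form)

HONEST FRAMING: bookkeeping HELPER for the crux K2 `KleimanSemiregularAnchor` (stmt-HodgeConjecture-25931). All
binders stay hypotheses; no stub, crux, rung or summit is proved; nothing toward HC / HC_AV / HC_CM.

Why this file (census row (v7) of the item, unit leafhand-hodge-kleimanbfseeds-3): K2 quantifies over EVERY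
inhabitant `C` of the hypothesis structure `ChernCharacterBetti`, whose fields pin `C.ch` on a concrete sheaf only
up to (at least) the rescaling `chᵢ ↦ tⁱ·chᵢ` (`HodgeTheory/ChernCharacterBettiRescale`) and give NO value of `ch₁`
on any specific line bundle; so no Buchweitz–Flenner sheaf seed (`HasBFSheafSeedAt C 3 P h w`: a sheaf with
PRESCRIBED `C`-Chern data) can ever be certified for an abstract `C` unless the sheaf is assembled, by exact
sequences, from modules whose `C`-character the fields determine. The tree's typed normalisation
`ChernCharacterBetti.IsTwistNormalised C` (`HodgeTheory/ChernCharacterBettiTwistNormalised`, p782779: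
`ch₁(𝒪_X(-m)) = -m·f^*H` on Serre's twisting sheaves `serreTwist f m`, `H` spanning `H²(ℙᴺ; ℚ)`) is exactly
what makes monads / extensions of twisting sheaves `C`-evaluable (`IsTwistNormalised.exists_ch_serreTwist_one_eq_smul_map`
+ the exponential field). Since the deciding theorem `closes` applies K2 only to the ONE `C` produced by the
construction crux, the route loses nothing by (i) asking the construction crux for a twist-normalised Kleiman `C`
(K-C⁺ᵀ := `∃ C, C.IsTwistNormalised ∧ C.KleimanChernNormalForm` — for the intended instance `cl ∘ ch` both are
printed theorems) and (ii) restating K2 over such `C` (K2ᵀ). This file is the kernel certificate of that re-glue: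

* `weilSixfolds_of_kleimanSemiregularAnchorAt_twistNormalisedC` — K-C⁺ᵀ → BFVariationalHodge → K2ᵀ →
  KodairaHyperplaneClass → HyperbolicFloor → SimilarReach → WeilSixfolds (verbatim the proof of `closes`; the
  Kleiman-only variant is `weilSixfolds_of_kleimanSemiregularAnchorAt_kleimanC`, p811808);
* `kleimanChernCharacterOnBetti_of_twistNormalisedKleiman` — K-C⁺ᵀ ⟹ K-C⁺ (the strengthened construction crux
  implies the filed one), and `kleimanSemiregularAnchorAt_twistNormalisedC_of_kleimanSemiregularAnchor` — K2 ⟹ K2ᵀ.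

References: [Fulton1998] §15.1 (ii)–(iii), Example 15.3.2; [Hirzebruch1966] §4.2 Axiom IV; [BuchweitzFlenner2003]
§5 Thm. 5.1; [vanGeemen1994HodgeAV] Lemma 5.2, 5.3–5.4.
-/

-- every declaration of this problem lives in `Summit.HodgeConjecture.HodgeConjecture.…` (summit = sub-problem)
set_option linter.dupNamespace false

noncomputable section

open CategoryTheory AlgebraicGeometry

namespace Summit.HodgeConjecture.HodgeConjecture.Theorems

open Literature.AlgebraicGeometry Literature.AlgebraicGeometry.Motives
open Literature.AlgebraicGeometry.HodgeTheory
open Literature.AlgebraicTopology.SingularHomology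
open Summit.HodgeConjecture.HodgeConjecture.Theses.KleimanBFSeeds

/-- **K-C⁺ᵀ ⟹ K-C⁺**: a twist-normalised Chern character with Kleiman's normal form witnesses the filed construction
crux `KleimanChernCharacterOnBetti`. [cite: Fulton1998, Example 15.3.2] -/
theorem kleimanChernCharacterOnBetti_of_twistNormalisedKleiman
    (h : ∃ C : ChernCharacterBetti, C.IsTwistNormalised ∧ C.KleimanChernNormalForm) :
    KleimanChernCharacterOnBetti := by
  obtain ⟨C, -, hK⟩ := h
  exact ⟨C, hK⟩

/-- **K2 ⟹ K2ᵀ** (restriction of the `∀ C` crux to twist-normalised Kleiman `C`). [cite: Fulton1998, §15.1 (iii)] -/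
theorem kleimanSemiregularAnchorAt_twistNormalisedC_of_kleimanSemiregularAnchor (k2 : KleimanSemiregularAnchor)
    (C : ChernCharacterBetti) (_hT : C.IsTwistNormalised) (_hK : C.KleimanChernNormalForm) :
      ∀ d : ℕ, 0 < d → ∀ (A : AbelianVariety ℂ) (φ : A ⟶ A), A.dim = 2 * 3 → φ ≫ φ = -(d • 𝟙 A) → (∀ (e :
      ProjectiveEmbedding A.X) (a : complexBetti (projectiveSpace e.n ℂ) 2), IsRationalClass a → a ≠ 0 → ¬
      IsHyperbolicWeilType A φ 3 ((d : ℂ) • complexBetti.map e.ι 2 a + complexBetti.map φ.hom.hom.hom 2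
      (complexBetti.map e.ι 2 a))) → (∃ wA : complexBetti A.X (2 * 3), wA ∈ weilClassesOf A φ 3 d ∧ wA ≠ 0 ∧
      IsOfHodgeType (2 * 3) A.X (2 * 3) 3 3 wA) → ∃ (eA : ProjectiveEmbedding A.X) (aA : complexBetti
      (projectiveSpace eA.n ℂ) 2) (P : AbelianVariety ℂ) (ψ₀ : P ⟶ P) (e e' : ProjectiveEmbedding P.X) (a :
      complexBetti (projectiveSpace e.n ℂ) 2) (a' : complexBetti (projectiveSpace e'.n ℂ) 2) (w : complexBetti
      P.X (2 * 3)), IsRationalClass aA ∧ aA ≠ 0 ∧ P.dim = 2 * 3 ∧ ψ₀ ≫ ψ₀ = -(d • 𝟙 P) ∧ IsRationalClass a ∧ a ≠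
      0 ∧ IsRationalClass a' ∧ a' ≠ 0 ∧ w ∈ weilClassesOf P ψ₀ 3 d ∧ IsRationalClass w ∧ w ≠ 0 ∧ IsOfHodgeType
      (2 * 3) P.X (2 * 3) 3 3 w ∧ IsHyperbolicWeilType P ψ₀ 3 ((d : ℂ) • complexBetti.map e'.ι 2 a' +
      complexBetti.map ψ₀.hom.hom.hom 2 (complexBetti.map e'.ι 2 a')) ∧ ¬ IsHyperbolicWeilType P ψ₀ 3 ((d : ℂ) •
      complexBetti.map e.ι 2 a + complexBetti.map ψ₀.hom.hom.hom 2 (complexBetti.map e.ι 2 a)) ∧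
      (HasWeilClassDesignAt C 3 P ((d : ℂ) • complexBetti.map e.ι 2 a + complexBetti.map ψ₀.hom.hom.hom 2
      (complexBetti.map e.ι 2 a)) w → HasBFSheafSeedAt C 3 P ((d : ℂ) • complexBetti.map e.ι 2 a +
      complexBetti.map ψ₀.hom.hom.hom 2 (complexBetti.map e.ι 2 a)) w) ∧ IsWeilSimilar 3 P ψ₀ ((d : ℂ) •
      complexBetti.map e.ι 2 a + complexBetti.map ψ₀.hom.hom.hom 2 (complexBetti.map e.ι 2 a)) A φ ((d : ℂ) •
      complexBetti.map eA.ι 2 aA + complexBetti.map φ.hom.hom.hom 2 (complexBetti.map eA.ι 2 aA)) :=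
  k2 C

/-- **`WeilSixfolds` from the route's binders with the construction crux strengthened to a TWIST-NORMALISED Kleiman
Chern character (K-C⁺ᵀ) and K2 restricted to such `C` (K2ᵀ)** — the evaluable re-glue of route `KleimanBFSeeds`:
`closes` applies K2 only at the constructed `C`. [cite: BuchweitzFlenner2003, §5 Thm. 5.1]
[cite: vanGeemen1994HodgeAV, Lemma 5.2 and 5.3–5.4] [cite: Hirzebruch1966, §4.2 Axiom IV] -/
theorem weilSixfolds_of_kleimanSemiregularAnchorAt_twistNormalisedC
    (hKCT : ∃ C : ChernCharacterBetti, C.IsTwistNormalised ∧ C.KleimanChernNormalForm)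
    (hBF : BFVariationalHodge)
    (k2T : ∀ C : ChernCharacterBetti, C.IsTwistNormalised → C.KleimanChernNormalForm →
      ∀ d : ℕ, 0 < d → ∀ (A : AbelianVariety ℂ) (φ : A ⟶ A), A.dim = 2 * 3 → φ ≫ φ = -(d • 𝟙 A) → (∀ (e :
      ProjectiveEmbedding A.X) (a : complexBetti (projectiveSpace e.n ℂ) 2), IsRationalClass a → a ≠ 0 → ¬
      IsHyperbolicWeilType A φ 3 ((d : ℂ) • complexBetti.map e.ι 2 a + complexBetti.map φ.hom.hom.hom 2
      (complexBetti.map e.ι 2 a))) → (∃ wA : complexBetti A.X (2 * 3), wA ∈ weilClassesOf A φ 3 d ∧ wA ≠ 0 ∧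
      IsOfHodgeType (2 * 3) A.X (2 * 3) 3 3 wA) → ∃ (eA : ProjectiveEmbedding A.X) (aA : complexBetti
      (projectiveSpace eA.n ℂ) 2) (P : AbelianVariety ℂ) (ψ₀ : P ⟶ P) (e e' : ProjectiveEmbedding P.X) (a :
      complexBetti (projectiveSpace e.n ℂ) 2) (a' : complexBetti (projectiveSpace e'.n ℂ) 2) (w : complexBetti
      P.X (2 * 3)), IsRationalClass aA ∧ aA ≠ 0 ∧ P.dim = 2 * 3 ∧ ψ₀ ≫ ψ₀ = -(d • 𝟙 P) ∧ IsRationalClass a ∧ a ≠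
      0 ∧ IsRationalClass a' ∧ a' ≠ 0 ∧ w ∈ weilClassesOf P ψ₀ 3 d ∧ IsRationalClass w ∧ w ≠ 0 ∧ IsOfHodgeType
      (2 * 3) P.X (2 * 3) 3 3 w ∧ IsHyperbolicWeilType P ψ₀ 3 ((d : ℂ) • complexBetti.map e'.ι 2 a' +
      complexBetti.map ψ₀.hom.hom.hom 2 (complexBetti.map e'.ι 2 a')) ∧ ¬ IsHyperbolicWeilType P ψ₀ 3 ((d : ℂ) •
      complexBetti.map e.ι 2 a + complexBetti.map ψ₀.hom.hom.hom 2 (complexBetti.map e.ι 2 a)) ∧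
      (HasWeilClassDesignAt C 3 P ((d : ℂ) • complexBetti.map e.ι 2 a + complexBetti.map ψ₀.hom.hom.hom 2
      (complexBetti.map e.ι 2 a)) w → HasBFSheafSeedAt C 3 P ((d : ℂ) • complexBetti.map e.ι 2 a +
      complexBetti.map ψ₀.hom.hom.hom 2 (complexBetti.map e.ι 2 a)) w) ∧ IsWeilSimilar 3 P ψ₀ ((d : ℂ) •
      complexBetti.map e.ι 2 a + complexBetti.map ψ₀.hom.hom.hom 2 (complexBetti.map e.ι 2 a)) A φ ((d : ℂ) •
      complexBetti.map eA.ι 2 aA + complexBetti.map φ.hom.hom.hom 2 (complexBetti.map eA.ι 2 aA)))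
    (hK : KodairaHyperplaneClass) (h₃ : HyperbolicFloor) (h₄ : SimilarReach) :
    Summit.HodgeConjecture.HodgeConjecture.Theses.SevenfoldWeilCensus.WeilSixfolds := by
  obtain ⟨C, hT, hCK⟩ := hKCT
  exact Summit.HodgeConjecture.HodgeConjecture.WeilTypeLadder.weilSixfolds_of_floor_of_reachSimilar_of_similarAnchorsAwayFromSplit
    h₃ h₄ (fun d hd A φ hA hφ hnh hwA => by
      obtain ⟨eA, aA, P, ψ₀, e, e', a, a', w, haA, haA0, hP, hψ, ha, ha0, ha', ha'0, hwW, hwrat, hw0, hwH, hhyp,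
        hnhyp, himp, hsim⟩ :=
        k2T C hT hCK d hd A φ hA hφ hnh hwA
      have hsp : IsSmoothProjective (2 * 3) P.X := hP ▸ AbelianVariety.isSmoothProjective_holds (A := P)
      have hwalg : w ∈ algebraicClasses P.X 3 := h₃ d hd P ψ₀ hP hsp hψ e' a' ha' ha'0 hhyp w hwrat hwH hwW
      have hPpos : 0 < P.dim := by rw [hP]; norm_num
      have hdesign : HasWeilClassDesignAt C 3 P
          ((d : ℂ) • complexBetti.map e.ι 2 a + complexBetti.map ψ₀.hom.hom.hom 2 (complexBetti.map e.ι 2 a)) w :=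
        hCK.hasWeilClassDesignAt_smul_add_map hK P hPpos ψ₀ e ha ha0 hd (by norm_num) hwrat hwalg
      exact ⟨eA, aA, P, ψ₀, e, a, w, haA, haA0, hP, hψ, ha, ha0, hwW, hwrat, hw0, hwH,
        weilAnchorLocalClause_of_BF_of_hasBFSheafSeedAt hBF C (by norm_num) d P _ w (himp hdesign), hsim⟩)

end Summit.HodgeConjecture.HodgeConjecture.Theorems

end
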